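import Summits.QuantumFields.BalabanUV.T4Continuum.Spine.CovariantInjectedTower
import Literature.MathematicalPhysics.QuantumFieldTheory.Balaban1983to89.B5Prop11Lower

/-!
# T⁴ programme, spine node NE2 (U1a) — THE BACKGROUND RESOLVENT LAW: the one-step η-rate laws of a PERTURBED propagator
# `(Δ + tP)⁻¹` from the laws of `Δ⁻¹`, by the exact resolvent identity (all orders in `t` inside the Neumann disc)

Ninth generation of the NE2 prover lineage P1 of the cell `pub-balaban` (technique «transfer King's scalar η-rate to Bałaban's
vector / BACKGROUND layers via the B5–B6 propagator representations»), file 1.  Generations 1–8 settled the `U = 1` layer of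
node U1a on a fixed finite torus; generation 8 TYPED the `U ≠ 1` wall as the hypothesis shapes
`CovariantAveragingTower.OneStepAveragedLaw` (sandwiched) and `CovariantInjectedTower.OneStepInjectedLaw` (injected), asserted by
nobody.  This file is the first step of the lineage INTO `U ≠ 1`, by the one representation of a background propagator that
needs no covariant carrier: the RESOLVENT representation.  A background field `U` changes Bałaban's operator `Δ_a` of
[Balaban1984PropagatorsI] (1.69)/(1.73) (resp. [Balaban1985BackgroundPropagators] (3.23)–(3.24)) to `Δ_a(U) = Δ_a + P(U)`,
`P(U) := Δ_a(U) − Δ_a(1)`, and `G(U) = (Δ_a + P(U))⁻¹`.  For ANY square matrices `D` (invertible), `P`, any coupling `t` with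
`‖t‖·‖P D⁻¹‖ < 1`, and any inter-level injection `J`, pure algebra gives:

 * §1 NEUMANN LEMMAS in the `ℓ²`-operator norm: `‖X‖ < 1 ⇒ 1 + X` invertible, `‖(1 + X)⁻¹‖ ≤ (1 − θ)⁻¹` (`‖X‖ ≤ θ < 1`) — proved
   WITHOUT series (injectivity + the fixed-point identity `B = 1 − XB`).
 * §2 PERTURBED INVERSES: `D + tP = (1 + t·PD⁻¹)D = D(1 + t·D⁻¹P)` is invertible when `‖t‖κ < 1`, `κ ≥ ‖PD⁻¹‖` (resp.
   `≥ ‖D⁻¹P‖`), with the NEUMANN FACTORS `‖D(D + tP)⁻¹‖, ‖(D + tP)⁻¹D‖ ≤ (1 − ‖t‖κ)⁻¹` and `‖(D + tP)⁻¹‖ ≤ ‖D⁻¹‖(1 − ‖t‖κ)⁻¹`.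
 * §3 THE LAWS.  With `E₁ := D′⁻¹J − JD⁻¹` (the unperturbed INJECTED defect), `E₂ := D′⁻¹(P′J − JP)D⁻¹` (the CONSISTENCY defect
   of the two perturbations read through one propagator on each side), `E₀ := D′⁻¹(1 − JJᴴ)` (the complement defect):
   **`perturbed_injected_law`** `‖(D′ + tP′)⁻¹J − J(D + tP)⁻¹‖ ≤ (‖E₁‖ + ‖t‖‖E₂‖)·(1 − ‖t‖κ)⁻²` — from the EXACT identity
   `G′(t)J − JG(t) = (G′(t)D′)·(E₁ − t·E₂)·(DG(t))`; **`perturbed_planted_law`** `‖(D′ + tP′)⁻¹ − J(D + tP)⁻¹Jᴴ‖ ≤ … +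
   ‖E₀‖(1 − ‖t‖κ)⁻¹`; **`perturbed_compressed_law`** (`JᴴJ = 1`); and **`perturbed_sandwich_law`**: for a normalised averaging `Ã`
   (`‖Ã‖ ≤ 1`) with `ÃJ = 1 + F`, `‖Ã(D′ + tP′)⁻¹Ãᴴ − (D + tP)⁻¹‖ ≤ planted + (‖FD⁻¹‖ + ‖D⁻¹Fᴴ‖)(1 − ‖t‖κ)⁻¹`.
 * The TOWER (level families, `OneStepAveragedLaw` / `TowerLimitRate` for the perturbed propagators `(D_k + tP_k)⁻¹` with the
   explicit constant `C(t) = (C₁ + ‖t‖C₂)ν² + (C₀ + 2C_F)ν`, `ν = (1 − ‖t‖κ)⁻¹`) is assembled in the companion file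
   `Spine/BackgroundResolventTower` from `perturbed_sandwich_law`.

WHAT THIS BUYS (honest).  The `U ≠ 1` wall of NE2 in its sandwiched shape is DISCHARGED for every perturbed carrier family MODULO
exactly two level-wise inequalities on the perturbation: (H-bd) `‖P_kD_k⁻¹‖, ‖D_k⁻¹P_k‖ ≤ κ` (relative boundedness — for
`P = Δ_a(U) − Δ_a` a first-order difference operator with the connection as coefficient this is of the TYPE of the printed uniform
bound [Balaban1984PropagatorsI] Prop. 1.1 (1.89) `|(∇G_k)(x,x′)| ≤ C…`, i.e. `‖∇𝒢‖ ≤ Cst` in the tree, times the size of the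
background) and (H-cons) `‖D_{k+1}⁻¹(P_{k+1}J_k − J_kP_k)D_k⁻¹‖ ≤ C₂ρ^k` (CONSISTENCY of the background's discretisations at two
adjacent spacings, read through one propagator on each side — the «canonical pairing» of the cell's record `t4/T4-EST-U1a.md`, NOT
IN PRINT).  Everything else — the `U = 1` planted law and complement defect — is supplied at `U = 1` by the lineage (file 2 of this
generation, `Support/KingPairingPlantedLaw`, from the tree's `B5G183RateTorusW.opNorm_Qavg_calG_rate`, `BalabanBlockPoincare`,
(1.89)).  The two inequalities are the EXACT MISSING ESTIMATES of NE2⁺ on this route; they are hypotheses here, asserted by nobody.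

HONEST FRAMING (T4-DAG p. 1).  Finite matrices, operator norm; [folklore]-level algebra (resolvent identities, Neumann bound),
statements OURS — [King1986] Lemma 4.5 p. 674 uses the same mechanism for the scalar `C^{(k)} = (Δ^{(k)} + B)⁻¹` at `A = 0` («we
successively replace each factor …», (4.32)); Bałaban prints no η-rate at all.  No conditional of the cell (`BetaPertH`, (B), (B^μ))
is used or hidden; NOT infinite volume, NOT a mass gap, NOT Clay, NOT summit progress; spine count unchanged (0/9).  HONEST
DEPENDENCY: continuum YM on T⁴ ⇐ BetaPertH ∧ nine spine estimates (0/9 proved); BetaPertH ⇐ (D1) ∧ (D4) ∧ CAP+tail; G-an2-4 gates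
asym, D1 and NE2/3/4.  ABSOLUTE RULE kept: no printed sentence is a hypothesis; no `sorry`.
-/

noncomputable section

open scoped BigOperators ComplexConjugate Matrix Matrix.Norms.L2Operator
open Filter Topology

namespace Summit.QuantumFields.BalabanUV.T4Continuum.BackgroundResolventLaw

open Literature.MathematicalPhysics.QuantumFieldTheory.Balaban1983to89.B5Prop11Lower (nsq nsq_nonneg nsq_mulVec_le)
open Summit.QuantumFields.BalabanUV.T4Continuum
open Summit.QuantumFields.BalabanUV.T4Continuum.CovariantAveragingTower (avgTow OneStepAveragedLaw TowerLimitRate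
  towerLimitRate_of_oneStepAveragedLaw)

/-! ## §1 Neumann lemmas in the `ℓ²`-operator norm (no series) -/

section Neumann

variable {m : Type*} [Fintype m] [DecidableEq m]

/-- `‖1‖ ≤ 1` for the `ℓ²`-operator norm (also on an empty index type). [folklore] -/
theorem l2_opNorm_one_le : ‖(1 : Matrix m m ℂ)‖ ≤ 1 := by
  rw [Matrix.cstar_norm_def, map_one]
  exact ContinuousLinearMap.norm_id_le

/-- **`1 + X` is invertible when `‖X‖ < 1`** (the kernel is trivial: `v = −Xv` forces `Σ|v|² ≤ ‖X‖²Σ|v|²`). [folklore] -/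
theorem isUnit_one_add_of_opNorm_lt_one {X : Matrix m m ℂ} (hX : ‖X‖ < 1) : IsUnit (1 + X) := by
  refine (Matrix.mulVec_injective_iff_isUnit).mp fun x y hxy => ?_
  have h0 : (1 + X) *ᵥ (x - y) = 0 := by rw [Matrix.mulVec_sub, hxy, sub_self]
  rw [Matrix.add_mulVec, Matrix.one_mulVec] at h0
  have h1 : x - y = -(X *ᵥ (x - y)) := eq_neg_of_add_eq_zero_left h0
  have h2 : nsq (X *ᵥ (x - y)) ≤ ‖X‖ ^ 2 * nsq (x - y) := nsq_mulVec_le X _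
  have e : nsq (X *ᵥ (x - y)) = nsq (x - y) := by
    conv_rhs => rw [h1]
    simp only [nsq, Pi.neg_apply, norm_neg]
  rw [e] at h2
  have hX2 : ‖X‖ ^ 2 < 1 := by
    have h := norm_nonneg X
    calc ‖X‖ ^ 2 < (1 : ℝ) ^ 2 := by gcongr
      _ = 1 := one_pow 2
  have h3 : nsq (x - y) = 0 := by
    by_contra hne
    have hpos : 0 < nsq (x - y) := lt_of_le_of_ne (nsq_nonneg _) (Ne.symm hne)
    have h4 : ‖X‖ ^ 2 * nsq (x - y) < 1 * nsq (x - y) := mul_lt_mul_of_pos_right hX2 hpos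
    linarith
  have h4 : ∀ i, (x - y) i = 0 := by
    intro i
    have h5 := (Finset.sum_eq_zero_iff_of_nonneg (fun i _ => sq_nonneg (‖(x - y) i‖))).mp h3 i (Finset.mem_univ i)
    exact norm_eq_zero.mp (pow_eq_zero_iff two_ne_zero |>.mp h5)
  funext i
  exact sub_eq_zero.mp (h4 i)

/-- **NEUMANN BOUND** `‖(1 + X)⁻¹‖ ≤ (1 − θ)⁻¹` for `‖X‖ ≤ θ < 1` — from the fixed-point identity `B = 1 − XB`, no series.
[folklore] -/
theorem opNorm_inv_one_add_le {X : Matrix m m ℂ} {θ : ℝ} (hX : ‖X‖ ≤ θ) (hθ : θ < 1) :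
    ‖(1 + X)⁻¹‖ ≤ (1 - θ)⁻¹ := by
  have hU : IsUnit (1 + X) := isUnit_one_add_of_opNorm_lt_one (lt_of_le_of_lt hX hθ)
  have hdet : IsUnit (1 + X).det := (Matrix.isUnit_iff_isUnit_det _).mp hU
  have hB : (1 + X)⁻¹ = 1 - X * (1 + X)⁻¹ := by
    have h := Matrix.mul_nonsing_inv (1 + X) hdet
    rw [Matrix.add_mul, Matrix.one_mul] at h
    exact eq_sub_of_add_eq h
  have h1 : ‖(1 + X)⁻¹‖ ≤ 1 + θ * ‖(1 + X)⁻¹‖ := by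
    calc ‖(1 + X)⁻¹‖ = ‖1 - X * (1 + X)⁻¹‖ := by rw [← hB]
      _ ≤ ‖(1 : Matrix m m ℂ)‖ + ‖X * (1 + X)⁻¹‖ := norm_sub_le _ _
      _ ≤ 1 + ‖X‖ * ‖(1 + X)⁻¹‖ := add_le_add l2_opNorm_one_le (Matrix.l2_opNorm_mul _ _)
      _ ≤ 1 + θ * ‖(1 + X)⁻¹‖ := by gcongr
  have hθ1 : 0 < 1 - θ := sub_pos.mpr hθ
  rw [show (1 - θ)⁻¹ = 1 / (1 - θ) from (one_div _).symm, le_div_iff₀ hθ1]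
  nlinarith [h1, norm_nonneg ((1 + X)⁻¹)]

end Neumann

/-! ## §2 Perturbed inverses `(D + tP)⁻¹` and their Neumann factors -/

section Perturbed

variable {m : Type*} [Fintype m] [DecidableEq m] {D P : Matrix m m ℂ}

/-- `D + tP = (1 + t·PD⁻¹)·D` for invertible `D`. [folklore] -/
theorem add_smul_eq_mul_right (hD : IsUnit D.det) (t : ℂ) : D + t • P = (1 + t • (P * D⁻¹)) * D := by
  rw [Matrix.add_mul, Matrix.one_mul, Matrix.smul_mul, Matrix.mul_assoc, Matrix.nonsing_inv_mul D hD, Matrix.mul_one]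

/-- `D + tP = D·(1 + t·D⁻¹P)` for invertible `D`. [folklore] -/
theorem add_smul_eq_mul_left (hD : IsUnit D.det) (t : ℂ) : D + t • P = D * (1 + t • (D⁻¹ * P)) := by
  rw [Matrix.mul_add, Matrix.mul_one, Matrix.mul_smul, ← Matrix.mul_assoc, Matrix.mul_nonsing_inv D hD, Matrix.one_mul]

/-- smallness of the right Neumann term: `‖t·PD⁻¹‖ ≤ ‖t‖κ`. [folklore] -/
theorem opNorm_smul_le_of_le {Y : Matrix m m ℂ} {κ : ℝ} (hY : ‖Y‖ ≤ κ) (t : ℂ) : ‖t • Y‖ ≤ ‖t‖ * κ := by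
  rw [norm_smul]; exact mul_le_mul_of_nonneg_left hY (norm_nonneg t)

/-- **`D + tP` is invertible** when `‖PD⁻¹‖ ≤ κ` and `‖t‖κ < 1`. [folklore] -/
theorem isUnit_add_smul_right (hD : IsUnit D.det) {t : ℂ} {κ : ℝ} (hP : ‖P * D⁻¹‖ ≤ κ) (ht : ‖t‖ * κ < 1) :
    IsUnit (D + t • P) := by
  rw [add_smul_eq_mul_right hD t]
  exact (isUnit_one_add_of_opNorm_lt_one (lt_of_le_of_lt (opNorm_smul_le_of_le hP t) ht)).mul
    ((Matrix.isUnit_iff_isUnit_det D).mpr hD)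

/-- **`D + tP` is invertible** when `‖D⁻¹P‖ ≤ κ` and `‖t‖κ < 1`. [folklore] -/
theorem isUnit_add_smul_left (hD : IsUnit D.det) {t : ℂ} {κ : ℝ} (hP : ‖D⁻¹ * P‖ ≤ κ) (ht : ‖t‖ * κ < 1) :
    IsUnit (D + t • P) := by
  rw [add_smul_eq_mul_left hD t]
  exact ((Matrix.isUnit_iff_isUnit_det D).mpr hD).mul
    (isUnit_one_add_of_opNorm_lt_one (lt_of_le_of_lt (opNorm_smul_le_of_le hP t) ht))

/-- determinant form of `isUnit_add_smul_right`. [folklore] -/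
theorem isUnit_det_add_smul_right (hD : IsUnit D.det) {t : ℂ} {κ : ℝ} (hP : ‖P * D⁻¹‖ ≤ κ) (ht : ‖t‖ * κ < 1) :
    IsUnit (D + t • P).det :=
  (Matrix.isUnit_iff_isUnit_det _).mp (isUnit_add_smul_right hD hP ht)

/-- determinant form of `isUnit_add_smul_left`. [folklore] -/
theorem isUnit_det_add_smul_left (hD : IsUnit D.det) {t : ℂ} {κ : ℝ} (hP : ‖D⁻¹ * P‖ ≤ κ) (ht : ‖t‖ * κ < 1) :
    IsUnit (D + t • P).det :=
  (Matrix.isUnit_iff_isUnit_det _).mp (isUnit_add_smul_left hD hP ht)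

/-- **RIGHT NEUMANN FACTOR** `‖D·(D + tP)⁻¹‖ ≤ (1 − ‖t‖κ)⁻¹` (`= ‖(1 + t·PD⁻¹)⁻¹‖`). [folklore] -/
theorem opNorm_mul_inv_add_smul_le (hD : IsUnit D.det) {t : ℂ} {κ : ℝ} (hP : ‖P * D⁻¹‖ ≤ κ) (ht : ‖t‖ * κ < 1) :
    ‖D * (D + t • P)⁻¹‖ ≤ (1 - ‖t‖ * κ)⁻¹ := by
  have e : D * (D + t • P)⁻¹ = (1 + t • (P * D⁻¹))⁻¹ := by
    rw [add_smul_eq_mul_right hD t, Matrix.mul_inv_rev, ← Matrix.mul_assoc, Matrix.mul_nonsing_inv D hD, Matrix.one_mul]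
  rw [e]
  exact opNorm_inv_one_add_le (opNorm_smul_le_of_le hP t) ht

/-- **LEFT NEUMANN FACTOR** `‖(D + tP)⁻¹·D‖ ≤ (1 − ‖t‖κ)⁻¹` (`= ‖(1 + t·D⁻¹P)⁻¹‖`). [folklore] -/
theorem opNorm_inv_add_smul_mul_le (hD : IsUnit D.det) {t : ℂ} {κ : ℝ} (hP : ‖D⁻¹ * P‖ ≤ κ) (ht : ‖t‖ * κ < 1) :
    ‖(D + t • P)⁻¹ * D‖ ≤ (1 - ‖t‖ * κ)⁻¹ := by
  have e : (D + t • P)⁻¹ * D = (1 + t • (D⁻¹ * P))⁻¹ := by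
    rw [add_smul_eq_mul_left hD t, Matrix.mul_inv_rev, Matrix.mul_assoc, Matrix.nonsing_inv_mul D hD, Matrix.mul_one]
  rw [e]
  exact opNorm_inv_one_add_le (opNorm_smul_le_of_le hP t) ht

/-- **UNIFORM BOUND** `‖(D + tP)⁻¹‖ ≤ ‖D⁻¹‖·(1 − ‖t‖κ)⁻¹`. [folklore] -/
theorem opNorm_inv_add_smul_le (hD : IsUnit D.det) {t : ℂ} {κ : ℝ} (hP : ‖P * D⁻¹‖ ≤ κ) (ht : ‖t‖ * κ < 1) :
    ‖(D + t • P)⁻¹‖ ≤ ‖D⁻¹‖ * (1 - ‖t‖ * κ)⁻¹ := by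
  have e : (D + t • P)⁻¹ = D⁻¹ * (D * (D + t • P)⁻¹) := by
    rw [← Matrix.mul_assoc, Matrix.nonsing_inv_mul D hD, Matrix.one_mul]
  rw [e]
  exact (Matrix.l2_opNorm_mul _ _).trans (mul_le_mul_of_nonneg_left (opNorm_mul_inv_add_smul_le hD hP ht) (norm_nonneg _))

/-- the resolvent identity of the perturbation: `(D + tP)⁻¹ − D⁻¹ = −t·(D + tP)⁻¹·P·D⁻¹`. [folklore] -/
theorem inv_add_smul_sub_inv (hD : IsUnit D.det) {t : ℂ} {κ : ℝ} (hP : ‖P * D⁻¹‖ ≤ κ) (ht : ‖t‖ * κ < 1) :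
    (D + t • P)⁻¹ - D⁻¹ = -(t • ((D + t • P)⁻¹ * P * D⁻¹)) := by
  have hG := isUnit_det_add_smul_right hD hP ht
  have h1 : (D + t • P)⁻¹ * (D + t • P) = 1 := Matrix.nonsing_inv_mul _ hG
  have h2 : D * D⁻¹ = 1 := Matrix.mul_nonsing_inv D hD
  have e : (D + t • P)⁻¹ - D⁻¹ = (D + t • P)⁻¹ * (D - (D + t • P)) * D⁻¹ := by
    rw [Matrix.mul_sub, Matrix.sub_mul, Matrix.mul_assoc _ D D⁻¹, h2, Matrix.mul_one, h1, Matrix.one_mul]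
  rw [e, sub_add_cancel_left, Matrix.mul_neg, Matrix.neg_mul, Matrix.mul_smul, Matrix.smul_mul]

/-- **LIPSCHITZ IN THE COUPLING**: `‖(D + tP)⁻¹ − D⁻¹‖ ≤ ‖t‖κ·‖D⁻¹‖·(1 − ‖t‖κ)⁻¹` — the perturbed propagator moves by `O(‖t‖κ)`
(the shape of background-Lipschitz continuity AT FIXED LATTICE SPACING, cf. [Balaban1985BackgroundPropagators] Thm 3.4 p. 400,
here for an abstract relatively bounded perturbation; statement ours). [folklore] -/
theorem opNorm_inv_add_smul_sub_inv_le (hD : IsUnit D.det) {t : ℂ} {κ : ℝ} (hP : ‖P * D⁻¹‖ ≤ κ) (hP' : ‖D⁻¹ * P‖ ≤ κ)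
    (ht : ‖t‖ * κ < 1) : ‖(D + t • P)⁻¹ - D⁻¹‖ ≤ ‖t‖ * κ * ‖D⁻¹‖ * (1 - ‖t‖ * κ)⁻¹ := by
  rw [inv_add_smul_sub_inv hD hP ht, norm_neg, norm_smul]
  have e : (D + t • P)⁻¹ * P * D⁻¹ = ((D + t • P)⁻¹ * D) * (D⁻¹ * P) * D⁻¹ := by
    rw [Matrix.mul_assoc (D + t • P)⁻¹ D (D⁻¹ * P), ← Matrix.mul_assoc D D⁻¹ P, Matrix.mul_nonsing_inv D hD,
      Matrix.one_mul]
  rw [e]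
  have hν : 0 ≤ (1 - ‖t‖ * κ)⁻¹ := inv_nonneg.mpr (sub_nonneg.mpr ht.le)
  have hκ : 0 ≤ κ := (norm_nonneg _).trans hP
  calc ‖t‖ * ‖(D + t • P)⁻¹ * D * (D⁻¹ * P) * D⁻¹‖
      ≤ ‖t‖ * (‖(D + t • P)⁻¹ * D‖ * ‖D⁻¹ * P‖ * ‖D⁻¹‖) := by
        refine mul_le_mul_of_nonneg_left ?_ (norm_nonneg t)
        exact (Matrix.l2_opNorm_mul _ _).trans (mul_le_mul_of_nonneg_right (Matrix.l2_opNorm_mul _ _) (norm_nonneg _))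
    _ ≤ ‖t‖ * ((1 - ‖t‖ * κ)⁻¹ * κ * ‖D⁻¹‖) := by
        refine mul_le_mul_of_nonneg_left ?_ (norm_nonneg t)
        exact mul_le_mul_of_nonneg_right (mul_le_mul (opNorm_inv_add_smul_mul_le hD hP' ht) hP' (norm_nonneg _) hν)
          (norm_nonneg _)
    _ = ‖t‖ * κ * ‖D⁻¹‖ * (1 - ‖t‖ * κ)⁻¹ := by ring

end Perturbed

/-! ## §3 The perturbed injected / planted / compressed / sandwiched laws (two levels) -/

section Laws

variable {m n : Type*} [Fintype m] [DecidableEq m] [Fintype n] [DecidableEq n]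
variable {D P : Matrix n n ℂ} {D' P' : Matrix m m ℂ} {J : Matrix m n ℂ}

/-- the intertwining defect of the perturbed operators, FACTORED through the unperturbed defects:
`J(D + tP) − (D′ + tP′)J = D′·(E₁ − t·E₂)·D` with `E₁ = D′⁻¹J − JD⁻¹`, `E₂ = D′⁻¹(P′J − JP)D⁻¹`. [folklore] -/
theorem intertwine_eq (hD : IsUnit D.det) (hD' : IsUnit D'.det) (t : ℂ) :
    J * (D + t • P) - (D' + t • P') * J
      = D' * ((D'⁻¹ * J - J * D⁻¹) - t • (D'⁻¹ * (P' * J - J * P) * D⁻¹)) * D := by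
  have i1 : D' * (D'⁻¹ * J - J * D⁻¹) * D = J * D - D' * J := by
    rw [Matrix.mul_sub, Matrix.sub_mul, ← Matrix.mul_assoc D' D'⁻¹ J, Matrix.mul_nonsing_inv D' hD', Matrix.one_mul,
      ← Matrix.mul_assoc D' J D⁻¹, Matrix.mul_assoc (D' * J) D⁻¹ D, Matrix.nonsing_inv_mul D hD, Matrix.mul_one]
  have i2 : D' * (D'⁻¹ * (P' * J - J * P) * D⁻¹) * D = P' * J - J * P := by
    rw [← Matrix.mul_assoc D' (D'⁻¹ * (P' * J - J * P)) D⁻¹, ← Matrix.mul_assoc D' D'⁻¹ (P' * J - J * P),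
      Matrix.mul_nonsing_inv D' hD', Matrix.one_mul, Matrix.mul_assoc (P' * J - J * P) D⁻¹ D, Matrix.nonsing_inv_mul D hD,
      Matrix.mul_one]
  rw [Matrix.mul_sub D', Matrix.sub_mul _ _ D, Matrix.mul_smul, Matrix.smul_mul, i1, i2, Matrix.mul_add, Matrix.add_mul,
    Matrix.mul_smul, Matrix.smul_mul, smul_sub]
  abel

/-- **THE EXACT RESOLVENT IDENTITY behind the perturbed injected law**:
`G′(t)J − JG(t) = (G′(t)D′)·(E₁ − t·E₂)·(DG(t))`, `G(t) = (D + tP)⁻¹`, `G′(t) = (D′ + tP′)⁻¹`. [folklore] -/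
theorem perturbed_injected_eq (hD : IsUnit D.det) (hD' : IsUnit D'.det) {t : ℂ} (hG : IsUnit (D + t • P).det)
    (hG' : IsUnit (D' + t • P').det) :
    (D' + t • P')⁻¹ * J - J * (D + t • P)⁻¹
      = ((D' + t • P')⁻¹ * D') * ((D'⁻¹ * J - J * D⁻¹) - t • (D'⁻¹ * (P' * J - J * P) * D⁻¹)) * (D * (D + t • P)⁻¹) := by
  set G := (D + t • P)⁻¹ with hGdef
  set G' := (D' + t • P')⁻¹ with hG'def
  have h1 : (D + t • P) * G = 1 := Matrix.mul_nonsing_inv _ hG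
  have h2 : G' * (D' + t • P') = 1 := Matrix.nonsing_inv_mul _ hG'
  have key : G' * J - J * G = G' * (J * (D + t • P) - (D' + t • P') * J) * G := by
    rw [Matrix.mul_sub, Matrix.sub_mul, Matrix.mul_assoc G' (J * (D + t • P)) G, Matrix.mul_assoc J (D + t • P) G, h1,
      Matrix.mul_one, ← Matrix.mul_assoc G' (D' + t • P') J, h2, Matrix.one_mul]
  rw [key, intertwine_eq hD hD' t]
  simp only [Matrix.mul_assoc]

/-- **THE PERTURBED INJECTED LAW.**  `κ ≥ ‖PD⁻¹‖, ‖D′⁻¹P′‖`, `‖t‖κ < 1`, `‖D′⁻¹J − JD⁻¹‖ ≤ e₁`, `‖D′⁻¹(P′J − JP)D⁻¹‖ ≤ e₂` ⟹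
`‖(D′ + tP′)⁻¹J − J(D + tP)⁻¹‖ ≤ (e₁ + ‖t‖e₂)·((1 − ‖t‖κ)⁻¹)²`.  ALL ORDERS in `t`; no series. [folklore] -/
theorem perturbed_injected_law (hD : IsUnit D.det) (hD' : IsUnit D'.det) {t : ℂ} {κ e₁ e₂ : ℝ}
    (hP : ‖P * D⁻¹‖ ≤ κ) (hP' : ‖D'⁻¹ * P'‖ ≤ κ) (ht : ‖t‖ * κ < 1)
    (h₁ : ‖D'⁻¹ * J - J * D⁻¹‖ ≤ e₁) (h₂ : ‖D'⁻¹ * (P' * J - J * P) * D⁻¹‖ ≤ e₂) :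
    ‖(D' + t • P')⁻¹ * J - J * (D + t • P)⁻¹‖ ≤ (e₁ + ‖t‖ * e₂) * ((1 - ‖t‖ * κ)⁻¹) ^ 2 := by
  have hG := isUnit_det_add_smul_right hD hP ht
  have hG' := isUnit_det_add_smul_left hD' hP' ht
  rw [perturbed_injected_eq hD hD' hG hG']
  have hν : 0 ≤ (1 - ‖t‖ * κ)⁻¹ := inv_nonneg.mpr (sub_nonneg.mpr ht.le)
  have hE : ‖(D'⁻¹ * J - J * D⁻¹) - t • (D'⁻¹ * (P' * J - J * P) * D⁻¹)‖ ≤ e₁ + ‖t‖ * e₂ := by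
    refine (norm_sub_le _ _).trans (add_le_add h₁ ?_)
    rw [norm_smul]; exact mul_le_mul_of_nonneg_left h₂ (norm_nonneg t)
  have he : 0 ≤ e₁ + ‖t‖ * e₂ := (norm_nonneg _).trans hE
  have hL := opNorm_inv_add_smul_mul_le hD' hP' ht
  have hR := opNorm_mul_inv_add_smul_le hD hP ht
  calc _ ≤ ‖(D' + t • P')⁻¹ * D' * ((D'⁻¹ * J - J * D⁻¹) - t • (D'⁻¹ * (P' * J - J * P) * D⁻¹))‖ * ‖D * (D + t • P)⁻¹‖ :=
        Matrix.l2_opNorm_mul _ _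
    _ ≤ (‖(D' + t • P')⁻¹ * D'‖ * ‖(D'⁻¹ * J - J * D⁻¹) - t • (D'⁻¹ * (P' * J - J * P) * D⁻¹)‖) * ‖D * (D + t • P)⁻¹‖ :=
        mul_le_mul_of_nonneg_right (Matrix.l2_opNorm_mul _ _) (norm_nonneg _)
    _ ≤ ((1 - ‖t‖ * κ)⁻¹ * (e₁ + ‖t‖ * e₂)) * (1 - ‖t‖ * κ)⁻¹ :=
        mul_le_mul (mul_le_mul hL hE (norm_nonneg _) hν) hR (norm_nonneg _) (mul_nonneg hν he)
    _ = (e₁ + ‖t‖ * e₂) * ((1 - ‖t‖ * κ)⁻¹) ^ 2 := by ring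

/-- **THE PERTURBED PLANTED LAW**: with `‖J‖ ≤ 1` and the complement defect `‖D′⁻¹(1 − JJᴴ)‖ ≤ e₀`,
`‖(D′ + tP′)⁻¹ − J(D + tP)⁻¹Jᴴ‖ ≤ (e₁ + ‖t‖e₂)(1 − ‖t‖κ)⁻² + e₀(1 − ‖t‖κ)⁻¹` — from
`G′ − JGJᴴ = (G′J − JG)Jᴴ + (G′D′)·D′⁻¹(1 − JJᴴ)`. [folklore] -/
theorem perturbed_planted_law (hD : IsUnit D.det) (hD' : IsUnit D'.det) {t : ℂ} {κ e₀ e₁ e₂ : ℝ}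
    (hP : ‖P * D⁻¹‖ ≤ κ) (hP' : ‖D'⁻¹ * P'‖ ≤ κ) (ht : ‖t‖ * κ < 1) (hJ : ‖J‖ ≤ 1)
    (h₀ : ‖D'⁻¹ * (1 - J * Jᴴ)‖ ≤ e₀) (h₁ : ‖D'⁻¹ * J - J * D⁻¹‖ ≤ e₁)
    (h₂ : ‖D'⁻¹ * (P' * J - J * P) * D⁻¹‖ ≤ e₂) :
    ‖(D' + t • P')⁻¹ - J * (D + t • P)⁻¹ * Jᴴ‖
      ≤ (e₁ + ‖t‖ * e₂) * ((1 - ‖t‖ * κ)⁻¹) ^ 2 + e₀ * (1 - ‖t‖ * κ)⁻¹ := by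
  have hG' := isUnit_det_add_smul_left hD' hP' ht
  set G := (D + t • P)⁻¹
  set G' := (D' + t • P')⁻¹
  have h3 : G' * D' * (D'⁻¹ * (1 - J * Jᴴ)) = G' * (1 - J * Jᴴ) := by
    rw [Matrix.mul_assoc, ← Matrix.mul_assoc D' D'⁻¹ _, Matrix.mul_nonsing_inv D' hD', Matrix.one_mul]
  have e : G' - J * G * Jᴴ = (G' * J - J * G) * Jᴴ + (G' * D') * (D'⁻¹ * (1 - J * Jᴴ)) := by
    rw [h3, Matrix.sub_mul, Matrix.mul_sub, Matrix.mul_one, ← Matrix.mul_assoc G' J Jᴴ]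
    abel
  rw [e]
  have hν : 0 ≤ (1 - ‖t‖ * κ)⁻¹ := inv_nonneg.mpr (sub_nonneg.mpr ht.le)
  have hJ' : ‖Jᴴ‖ ≤ 1 := by rw [Matrix.l2_opNorm_conjTranspose]; exact hJ
  have hA := perturbed_injected_law hD hD' hP hP' ht h₁ h₂
  have hB := opNorm_inv_add_smul_mul_le hD' hP' ht
  calc ‖(G' * J - J * G) * Jᴴ + G' * D' * (D'⁻¹ * (1 - J * Jᴴ))‖
      ≤ ‖(G' * J - J * G) * Jᴴ‖ + ‖G' * D' * (D'⁻¹ * (1 - J * Jᴴ))‖ := norm_add_le _ _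
    _ ≤ ‖G' * J - J * G‖ * ‖Jᴴ‖ + ‖G' * D'‖ * ‖D'⁻¹ * (1 - J * Jᴴ)‖ :=
        add_le_add (Matrix.l2_opNorm_mul _ _) (Matrix.l2_opNorm_mul _ _)
    _ ≤ (e₁ + ‖t‖ * e₂) * ((1 - ‖t‖ * κ)⁻¹) ^ 2 * 1 + (1 - ‖t‖ * κ)⁻¹ * e₀ :=
        add_le_add (mul_le_mul hA hJ' (norm_nonneg _) ((norm_nonneg _).trans hA))
          (mul_le_mul hB h₀ (norm_nonneg _) hν)
    _ = (e₁ + ‖t‖ * e₂) * ((1 - ‖t‖ * κ)⁻¹) ^ 2 + e₀ * (1 - ‖t‖ * κ)⁻¹ := by ring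

/-- **THE PERTURBED COMPRESSED LAW** (`JᴴJ = 1`): `‖Jᴴ(D′ + tP′)⁻¹J − (D + tP)⁻¹‖ ≤ (e₁ + ‖t‖e₂)(1 − ‖t‖κ)⁻²` — the finer
perturbed propagator READ ON THE INJECTED FUNCTIONS is the coarser one up to the two defects. [folklore] -/
theorem perturbed_compressed_law (hD : IsUnit D.det) (hD' : IsUnit D'.det) {t : ℂ} {κ e₁ e₂ : ℝ}
    (hP : ‖P * D⁻¹‖ ≤ κ) (hP' : ‖D'⁻¹ * P'‖ ≤ κ) (ht : ‖t‖ * κ < 1) (hJJ : Jᴴ * J = 1) (hJ : ‖J‖ ≤ 1)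
    (h₁ : ‖D'⁻¹ * J - J * D⁻¹‖ ≤ e₁) (h₂ : ‖D'⁻¹ * (P' * J - J * P) * D⁻¹‖ ≤ e₂) :
    ‖Jᴴ * (D' + t • P')⁻¹ * J - (D + t • P)⁻¹‖ ≤ (e₁ + ‖t‖ * e₂) * ((1 - ‖t‖ * κ)⁻¹) ^ 2 := by
  have e : Jᴴ * (D' + t • P')⁻¹ * J - (D + t • P)⁻¹ = Jᴴ * ((D' + t • P')⁻¹ * J - J * (D + t • P)⁻¹) := by
    rw [Matrix.mul_sub, ← Matrix.mul_assoc Jᴴ J, hJJ, Matrix.one_mul, Matrix.mul_assoc]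
  rw [e]
  have hJ' : ‖Jᴴ‖ ≤ 1 := by rw [Matrix.l2_opNorm_conjTranspose]; exact hJ
  have hA := perturbed_injected_law hD hD' hP hP' ht h₁ h₂
  calc _ ≤ ‖Jᴴ‖ * ‖(D' + t • P')⁻¹ * J - J * (D + t • P)⁻¹‖ := Matrix.l2_opNorm_mul _ _
    _ ≤ 1 * ((e₁ + ‖t‖ * e₂) * ((1 - ‖t‖ * κ)⁻¹) ^ 2) := mul_le_mul hJ' hA (norm_nonneg _) zero_le_one
    _ = _ := one_mul _

/-- **THE PERTURBED SANDWICHED LAW** (the currency of `CovariantAveragingTower.OneStepAveragedLaw`): for a NORMALISED averaging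
`Ã : fine → coarse` (`‖Ã‖ ≤ 1`) whose composition with the injection is `ÃJ = 1 + F`, with `‖FD⁻¹‖, ‖D⁻¹Fᴴ‖ ≤ f`:
`‖Ã(D′ + tP′)⁻¹Ãᴴ − (D + tP)⁻¹‖ ≤ (e₁ + ‖t‖e₂)ν² + (e₀ + 2f)ν`, `ν = (1 − ‖t‖κ)⁻¹` — from
`ÃG′Ãᴴ − G = Ã(G′ − JGJᴴ)Ãᴴ + (FD⁻¹)(DG)(ÃJ)ᴴ + (GD)(D⁻¹Fᴴ)`.  For KING's pairing `J = L^{d/2}Q_Lᴴ` of the pure block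
averaging `F = 0`. [folklore] -/
theorem perturbed_sandwich_law (hD : IsUnit D.det) (hD' : IsUnit D'.det) {t : ℂ} {κ e₀ e₁ e₂ f : ℝ}
    (hP : ‖P * D⁻¹‖ ≤ κ) (hPl : ‖D⁻¹ * P‖ ≤ κ) (hP' : ‖D'⁻¹ * P'‖ ≤ κ) (ht : ‖t‖ * κ < 1)
    {At : Matrix n m ℂ} (hAt : ‖At‖ ≤ 1) (hJ : ‖J‖ ≤ 1) {F : Matrix n n ℂ} (hAJ : At * J = 1 + F)
    (hF : ‖F * D⁻¹‖ ≤ f) (hF' : ‖D⁻¹ * Fᴴ‖ ≤ f)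
    (h₀ : ‖D'⁻¹ * (1 - J * Jᴴ)‖ ≤ e₀) (h₁ : ‖D'⁻¹ * J - J * D⁻¹‖ ≤ e₁)
    (h₂ : ‖D'⁻¹ * (P' * J - J * P) * D⁻¹‖ ≤ e₂) :
    ‖At * (D' + t • P')⁻¹ * Atᴴ - (D + t • P)⁻¹‖
      ≤ (e₁ + ‖t‖ * e₂) * ((1 - ‖t‖ * κ)⁻¹) ^ 2 + (e₀ + 2 * f) * (1 - ‖t‖ * κ)⁻¹ := by
  have hGdet := isUnit_det_add_smul_right hD hP ht
  set G := (D + t • P)⁻¹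
  set G' := (D' + t • P')⁻¹
  -- the algebra
  have hGD : G * D * (D⁻¹ * Fᴴ) = G * Fᴴ := by
    rw [Matrix.mul_assoc, ← Matrix.mul_assoc D D⁻¹ Fᴴ, Matrix.mul_nonsing_inv D hD, Matrix.one_mul]
  have hDG : F * D⁻¹ * (D * G) = F * G := by
    rw [Matrix.mul_assoc, ← Matrix.mul_assoc D⁻¹ D G, Matrix.nonsing_inv_mul D hD, Matrix.one_mul]
  have e2 : At * (J * G * Jᴴ) * Atᴴ = (At * J) * G * (At * J)ᴴ := by
    rw [Matrix.conjTranspose_mul]; simp only [Matrix.mul_assoc]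
  have e : At * G' * Atᴴ - G
      = At * (G' - J * G * Jᴴ) * Atᴴ + (F * D⁻¹ * (D * G)) * (At * J)ᴴ + G * D * (D⁻¹ * Fᴴ) := by
    rw [hGD, hDG, Matrix.mul_sub, Matrix.sub_mul, e2, hAJ, Matrix.conjTranspose_add, Matrix.conjTranspose_one]
    simp only [Matrix.add_mul, Matrix.mul_add, Matrix.one_mul, Matrix.mul_one]
    abel
  rw [e]
  have hν : 0 ≤ (1 - ‖t‖ * κ)⁻¹ := inv_nonneg.mpr (sub_nonneg.mpr ht.le)
  have hf : 0 ≤ f := (norm_nonneg _).trans hF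
  have hAt' : ‖Atᴴ‖ ≤ 1 := by rw [Matrix.l2_opNorm_conjTranspose]; exact hAt
  have hAJn : ‖(At * J)ᴴ‖ ≤ 1 := by
    rw [Matrix.l2_opNorm_conjTranspose]
    calc ‖At * J‖ ≤ ‖At‖ * ‖J‖ := Matrix.l2_opNorm_mul _ _
      _ ≤ 1 * 1 := mul_le_mul hAt hJ (norm_nonneg _) zero_le_one
      _ = 1 := one_mul 1
  have hplant := perturbed_planted_law hD hD' hP hP' ht hJ h₀ h₁ h₂
  have hplant0 : 0 ≤ (e₁ + ‖t‖ * e₂) * ((1 - ‖t‖ * κ)⁻¹) ^ 2 + e₀ * (1 - ‖t‖ * κ)⁻¹ := (norm_nonneg _).trans hplant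
  have hR := opNorm_mul_inv_add_smul_le hD hP ht
  have hL := opNorm_inv_add_smul_mul_le hD hPl ht
  have t1 : ‖At * (G' - J * G * Jᴴ) * Atᴴ‖ ≤ (e₁ + ‖t‖ * e₂) * ((1 - ‖t‖ * κ)⁻¹) ^ 2 + e₀ * (1 - ‖t‖ * κ)⁻¹ := by
    calc _ ≤ ‖At * (G' - J * G * Jᴴ)‖ * ‖Atᴴ‖ := Matrix.l2_opNorm_mul _ _
      _ ≤ ‖At‖ * ‖G' - J * G * Jᴴ‖ * ‖Atᴴ‖ := mul_le_mul_of_nonneg_right (Matrix.l2_opNorm_mul _ _) (norm_nonneg _)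
      _ ≤ 1 * ((e₁ + ‖t‖ * e₂) * ((1 - ‖t‖ * κ)⁻¹) ^ 2 + e₀ * (1 - ‖t‖ * κ)⁻¹) * 1 :=
          mul_le_mul (mul_le_mul hAt hplant (norm_nonneg _) zero_le_one) hAt' (norm_nonneg _) (by positivity)
      _ = _ := by ring
  have t2 : ‖F * D⁻¹ * (D * G) * (At * J)ᴴ‖ ≤ f * (1 - ‖t‖ * κ)⁻¹ := by
    calc _ ≤ ‖F * D⁻¹ * (D * G)‖ * ‖(At * J)ᴴ‖ := Matrix.l2_opNorm_mul _ _
      _ ≤ ‖F * D⁻¹‖ * ‖D * G‖ * ‖(At * J)ᴴ‖ := mul_le_mul_of_nonneg_right (Matrix.l2_opNorm_mul _ _) (norm_nonneg _)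
      _ ≤ f * (1 - ‖t‖ * κ)⁻¹ * 1 :=
          mul_le_mul (mul_le_mul hF hR (norm_nonneg _) hf) hAJn (norm_nonneg _) (mul_nonneg hf hν)
      _ = _ := mul_one _
  have t3 : ‖G * D * (D⁻¹ * Fᴴ)‖ ≤ (1 - ‖t‖ * κ)⁻¹ * f :=
    (Matrix.l2_opNorm_mul _ _).trans (mul_le_mul hL hF' (norm_nonneg _) hν)
  calc _ ≤ ‖At * (G' - J * G * Jᴴ) * Atᴴ + F * D⁻¹ * (D * G) * (At * J)ᴴ‖ + ‖G * D * (D⁻¹ * Fᴴ)‖ := norm_add_le _ _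
    _ ≤ (‖At * (G' - J * G * Jᴴ) * Atᴴ‖ + ‖F * D⁻¹ * (D * G) * (At * J)ᴴ‖) + ‖G * D * (D⁻¹ * Fᴴ)‖ :=
        add_le_add (norm_add_le _ _) le_rfl
    _ ≤ ((e₁ + ‖t‖ * e₂) * ((1 - ‖t‖ * κ)⁻¹) ^ 2 + e₀ * (1 - ‖t‖ * κ)⁻¹ + f * (1 - ‖t‖ * κ)⁻¹)
          + (1 - ‖t‖ * κ)⁻¹ * f := add_le_add (add_le_add t1 t2) t3
    _ = _ := by ring

end Laws

end Summit.QuantumFields.BalabanUV.T4Continuum.BackgroundResolventLaw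

end
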